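import Mathlib
import Literature.Geometry.Lorentzian.KerrSchild
import Literature.Geometry.Lorentzian.BoundedGeometry

/-!
# Route PhotonSphereChannels · crux `TameCensorship` (stmt-FinalStateConjecture-17431) · line `Sketch`, skeleton v5 ·
# stub `stub_screenFrame`: under the `C⁰ ≤ ½` pin a null pair completes to an adapted null frame with bounded screen legs

Helper file (`--supports stmt-FinalStateConjecture-17431`) of line `Sketch` (lead c2, 2026-08-17), brick P3b of the
PANCAKE LAW (alternative route to clause (a) of K3, skeleton v5). With `G = Ψ^* g` the chart metric of a tame chart of
clause (ii) (`‖G − η‖ ≤ ½`, `η = Minkowski.bilin` on `E4 = EuclideanSpace ℝ (Fin 4)`), a null pair `ℓ, n`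
(`G(ℓ,ℓ) = 0`, `G(ℓ,n) = −1`) is completed by two SCREEN LEGS `e₂, e₃`: `G`-orthonormal, `G`-orthogonal to `ℓ` and
to `n`, with chart norms `‖e_A‖ ≤ 2 + 3 ‖ℓ‖ ‖n‖`. Pure linear algebra on `E4`.

References: B. O'Neill, *Semi-Riemannian Geometry* (1983), Ch. 2, Lemmas 2.24–2.26 (orthonormal expansion,
nondegenerate subspaces); Ch. 5, Lemma 5.26.
-/

set_option linter.dupNamespace false

open Literature.Geometry.Lorentzian

noncomputable section

namespace Summit.FinalStateConjecture.FinalStateConjecture.Theorems.PhotonSphereChannels.TameCensorshipUnwind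

/-- Pointwise form of the operator-norm pin: `|G(v, w) − η(v, w)| ≤ ‖G − η‖ ‖v‖ ‖w‖ ≤ ½ ‖v‖ ‖w‖`
(`ContinuousLinearMap.le_opNorm₂`). [folklore] -/
private theorem screen_abs_sub_bilin_le {G : E4 →L[ℝ] E4 →L[ℝ] ℝ}
    (hpin : ‖G - Minkowski.bilin‖ ≤ 1 / 2) (v w : E4) :
    |G v w - Minkowski.bilin v w| ≤ 1 / 2 * ‖v‖ * ‖w‖ := by
  have h1 := (G - Minkowski.bilin).le_opNorm₂ v w
  rw [sub_apply, sub_apply, Real.norm_eq_abs] at h1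
  exact h1.trans (by gcongr)

/-- Pythagoras for the time/space splitting of the Euclidean norm on `E4`:
`‖v‖² = (v⁰)² + ∑ᵢ (vⁱ)²`. [folklore] -/
private theorem screen_norm_sq_split (v : E4) : ‖v‖ ^ 2 = v 0 ^ 2 + ∑ i : Fin 3, v i.succ ^ 2 := by
  rw [EuclideanSpace.real_norm_sq_eq, Fin.sum_univ_succ]

/-- `η(v, v) = ‖v‖² − 2 (v⁰)²` on `E4` (O'Neill 1983, Ch. 5, Ex. 5.1). [folklore] -/
private theorem screen_bilin_self_eq (v : E4) : Minkowski.bilin v v = ‖v‖ ^ 2 - 2 * v 0 ^ 2 := by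
  rw [Minkowski.bilin_apply, screen_norm_sq_split]
  simp only [pow_two]
  ring

/-- Spatial chart vectors are uniformly `G`-spacelike under the pin: if `v⁰ = 0` then
`η(v, v) = ‖v‖²`, hence `G(v, v) ≥ ‖v‖² − ½ ‖v‖² = ‖v‖²/2`. [folklore] -/
private theorem screen_sq_le {G : E4 →L[ℝ] E4 →L[ℝ] ℝ} (hpin : ‖G - Minkowski.bilin‖ ≤ 1 / 2)
    (v : E4) (hv : v 0 = 0) : ‖v‖ ^ 2 / 2 ≤ G v v := by
  have h1 := screen_abs_sub_bilin_le hpin v v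
  rw [screen_bilin_self_eq, hv] at h1
  nlinarith [(abs_le.1 h1).1]

/-- `G`-normalisation of a nonzero spatial vector `v`: `u = v / √G(v, v)` has `G(u, u) = 1` and
`‖u‖ = ‖v‖ / √G(v, v) ≤ √2 ≤ 2` because `G(v, v) ≥ ‖v‖²/2`. [folklore] -/
private theorem screen_normalise {G : E4 →L[ℝ] E4 →L[ℝ] ℝ} (hpin : ‖G - Minkowski.bilin‖ ≤ 1 / 2)
    (v : E4) (hv : v 0 = 0) (hv0 : v ≠ 0) :
    ∃ (u : E4) (c : ℝ), u = c • v ∧ G u u = 1 ∧ ‖u‖ ≤ 2 := by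
  have hq := screen_sq_le hpin v hv
  have hvpos : 0 < ‖v‖ := norm_pos_iff.2 hv0
  have hqpos : 0 < G v v := lt_of_lt_of_le (by positivity) hq
  have hs : 0 < Real.sqrt (G v v) := Real.sqrt_pos.2 hqpos
  refine ⟨(Real.sqrt (G v v))⁻¹ • v, (Real.sqrt (G v v))⁻¹, rfl, ?_, ?_⟩
  · simp only [map_smul, smul_apply, smul_eq_mul]
    rw [← mul_assoc, ← mul_inv, Real.mul_self_sqrt hqpos.le, inv_mul_cancel₀ hqpos.ne']
  · rw [norm_smul, Real.norm_eq_abs, abs_of_pos (inv_pos.2 hs), inv_mul_le_iff₀ hs]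
    refine le_of_sq_le_sq ?_ (by positivity)
    rw [mul_pow, Real.sq_sqrt hqpos.le]
    nlinarith [hq, sq_nonneg ‖v‖]

/-- The Gram–Schmidt residual of a Euclidean-orthonormal pair is nonzero:
`⟪w₃, w₃ − a w₂⟫ = ‖w₃‖² = 1`. [folklore] -/
private theorem screen_residual_ne_zero {w₂ w₃ : E4} (h₃ : ‖w₃‖ = 1)
    (h₂₃ : inner ℝ w₂ w₃ = 0) (a : ℝ) : w₃ - a • w₂ ≠ 0 := by
  intro h
  have h1 : inner ℝ w₃ (w₃ - a • w₂) = 0 := by rw [h, inner_zero_right]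
  rw [inner_sub_right, real_inner_smul_right, (real_inner_comm w₂ w₃).trans h₂₃, mul_zero,
    sub_zero, real_inner_self_eq_norm_sq, h₃, one_pow] at h1
  exact one_ne_zero h1

/-- Bilinear expansion of the `n`-corrected legs: if `G(ℓ, ℓ) = 0` and `u, v` are `G`-orthogonal
to `ℓ`, then `G(u + a ℓ, v + b ℓ) = G(u, v)`. [folklore] -/
private theorem screen_shift_shift (G : E4 →L[ℝ] E4 →L[ℝ] ℝ) (hG : ∀ v w : E4, G v w = G w v)
    {ℓ : E4} (hℓ : G ℓ ℓ = 0) {u v : E4} (hu : G u ℓ = 0) (hv : G v ℓ = 0) (a b : ℝ) :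
    G (u + a • ℓ) (v + b • ℓ) = G u v := by
  have hℓv : G ℓ v = 0 := (hG ℓ v).trans hv
  simp [map_add, map_smul, hu, hℓ, hℓv]

/-- The `n`-corrected legs stay `G`-orthogonal to `ℓ`: `G(ℓ, u + a ℓ) = G(ℓ, u) + a G(ℓ, ℓ) = 0`.
[folklore] -/
private theorem screen_shift_ℓ (G : E4 →L[ℝ] E4 →L[ℝ] ℝ) {ℓ u : E4} (hℓ : G ℓ ℓ = 0)
    (hℓu : G ℓ u = 0) (a : ℝ) : G ℓ (u + a • ℓ) = 0 := by
  simp [map_add, map_smul, hℓ, hℓu]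

/-- The `n`-correction kills the `n`-component: with `G(ℓ, n) = −1`,
`G(n, u + G(u, n) ℓ) = G(n, u) − G(u, n) = 0` by symmetry. [folklore] -/
private theorem screen_shift_n (G : E4 →L[ℝ] E4 →L[ℝ] ℝ) (hG : ∀ v w : E4, G v w = G w v)
    {ℓ n : E4} (hℓn : G ℓ n = -1) (u : E4) : G n (u + G u n • ℓ) = 0 := by
  have hnℓ : G n ℓ = -1 := (hG n ℓ).trans hℓn
  have hnu : G n u = G u n := hG n u
  simp [map_add, map_smul, hnℓ, hnu]

/-- Chart-norm bound for the `n`-corrected legs: `‖G‖ ≤ ‖G − η‖ + ‖η‖ ≤ 3⁄2`, so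
`‖u + G(u, n) ℓ‖ ≤ ‖u‖ + ‖G‖ ‖u‖ ‖n‖ ‖ℓ‖ ≤ 2 + 3 ‖ℓ‖ ‖n‖` when `‖u‖ ≤ 2`. [folklore] -/
private theorem screen_shift_norm {G : E4 →L[ℝ] E4 →L[ℝ] ℝ} (hpin : ‖G - Minkowski.bilin‖ ≤ 1 / 2)
    (ℓ n u : E4) (hu : ‖u‖ ≤ 2) : ‖u + G u n • ℓ‖ ≤ 2 + 3 * ‖ℓ‖ * ‖n‖ := by
  have hGn : ‖G‖ ≤ 3 / 2 := by
    have h1 := norm_sub_norm_le G Minkowski.bilin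
    linarith [Minkowski.norm_bilin_le_one]
  have h2 : ‖G u n‖ ≤ ‖G‖ * ‖u‖ * ‖n‖ := G.le_opNorm₂ u n
  calc ‖u + G u n • ℓ‖ ≤ ‖u‖ + ‖G u n • ℓ‖ := norm_add_le _ _
    _ = ‖u‖ + ‖G u n‖ * ‖ℓ‖ := by rw [norm_smul]
    _ ≤ 2 + ‖G‖ * ‖u‖ * ‖n‖ * ‖ℓ‖ := by gcongr
    _ ≤ 2 + 3 / 2 * 2 * ‖n‖ * ‖ℓ‖ := by gcongr
    _ = 2 + 3 * ‖ℓ‖ * ‖n‖ := by ring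

/-- **Stub `stub_screenFrame` of line `Sketch` (skeleton v5) for the crux `PhotonSphereChannels.TameCensorship`
(stmt-FinalStateConjecture-17431).** For a symmetric bilinear form `G` on `E4` with `‖G − η‖ ≤ ½` and `ℓ, n` with
`G(ℓ,ℓ) = 0`, `G(ℓ,n) = −1`, there are `e₂, e₃` with `G(e_A, e_B) = δ_{AB}`, `G(ℓ, e_A) = G(n, e_A) = 0` and
`‖e_A‖ ≤ 2 + 3 ‖ℓ‖ ‖n‖`. Proof: on `S = {v | v⁰ = 0}` one has `G(v,v) = ‖v‖² + (G − η)(v,v) ≥ ‖v‖²/2`; the subspace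
`W = {v ∈ S | G(v, ℓ) = 0}` has dimension `≥ 2` (kernel of two functionals on `E4`); Gram–Schmidt for `G` on two
Euclidean-orthonormal vectors `w₂, w₃ ∈ W` gives `ê₂ = w₂ / √G(w₂,w₂)`, `ê₃ = ê₃'/√G(ê₃',ê₃')` with
`ê₃' = w₃ − G(w₃, ê₂) ê₂`, all in `W`, `G`-orthonormal, `‖ê_A‖ ≤ √2` (because `G(w,w) ≥ ‖w‖²/2` and
`‖ê₃'‖ ≥ 1`); finally `e_A := ê_A + G(ê_A, n) ℓ` is still `G`-orthonormal and `G`-orthogonal to `ℓ` (`G(ℓ,ℓ) = 0`)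
and now also to `n` (`G(ℓ,n) = −1`), with `‖e_A‖ ≤ √2 + ‖G‖ √2 ‖n‖ ‖ℓ‖ ≤ √2 (1 + (3⁄2) ‖ℓ‖ ‖n‖)`. [folklore;
O'Neill 1983, Ch. 2] -/
theorem stub_screenFrame :
    ∀ (G : E4 →L[ℝ] E4 →L[ℝ] ℝ), (∀ v w : E4, G v w = G w v) → ‖G - Minkowski.bilin‖ ≤ 1 / 2 →
    ∀ ℓ n : E4, G ℓ ℓ = 0 → G ℓ n = -1 →
    ∃ e₂ e₃ : E4, G e₂ e₂ = 1 ∧ G e₃ e₃ = 1 ∧ G e₂ e₃ = 0 ∧ G ℓ e₂ = 0 ∧ G ℓ e₃ = 0 ∧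
      G n e₂ = 0 ∧ G n e₃ = 0 ∧ ‖e₂‖ ≤ 2 + 3 * ‖ℓ‖ * ‖n‖ ∧ ‖e₃‖ ≤ 2 + 3 * ‖ℓ‖ * ‖n‖ := by
  intro G hG hpin ℓ n hℓ hℓn
  -- the subspace `W = {v | v⁰ = 0, G(v, ℓ) = 0}` as the kernel of `φ : v ↦ (v⁰, G(v, ℓ))`
  let φ : E4 →ₗ[ℝ] ℝ × ℝ :=
    ((E4.dx 0 : E4 →L[ℝ] ℝ) : E4 →ₗ[ℝ] ℝ).prod ((G.flip ℓ : E4 →L[ℝ] ℝ) : E4 →ₗ[ℝ] ℝ)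
  have hφ : ∀ v : E4, φ v = (v 0, G v ℓ) := fun v ↦ rfl
  have hmem : ∀ v : E4, v ∈ LinearMap.ker φ → v 0 = 0 ∧ G v ℓ = 0 := by
    intro v hv
    have h1 : φ v = 0 := LinearMap.mem_ker.1 hv
    rwa [hφ, Prod.mk_eq_zero] at h1
  -- rank–nullity: `dim W ≥ 4 − 2`
  have hW : 2 ≤ Module.finrank ℝ (LinearMap.ker φ) := by
    have h1 : Module.finrank ℝ (LinearMap.range φ) + Module.finrank ℝ (LinearMap.ker φ) =
        Module.finrank ℝ E4 := LinearMap.finrank_range_add_finrank_ker φ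
    have h2 : Module.finrank ℝ (LinearMap.range φ) ≤ 2 :=
      (Submodule.finrank_le _).trans_eq (by simp)
    have h3 : Module.finrank ℝ E4 = 4 := finrank_euclideanSpace_fin
    omega
  -- two Euclidean-orthonormal vectors of `W`
  obtain ⟨w₂, w₃, hw₂, hw₃, hn₂, hn₃, h₂₃⟩ : ∃ w₂ w₃ : E4, w₂ ∈ LinearMap.ker φ ∧
      w₃ ∈ LinearMap.ker φ ∧ ‖w₂‖ = 1 ∧ ‖w₃‖ = 1 ∧ inner ℝ w₂ w₃ = 0 := by
    let b := stdOrthonormalBasis ℝ (LinearMap.ker φ)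
    have h0 : 0 < Module.finrank ℝ (LinearMap.ker φ) := by omega
    have h1 : 1 < Module.finrank ℝ (LinearMap.ker φ) := by omega
    refine ⟨b ⟨0, h0⟩, b ⟨1, h1⟩, (b _).2, (b _).2, ?_, ?_, ?_⟩
    · rw [Submodule.norm_coe]; exact b.norm_eq_one _
    · rw [Submodule.norm_coe]; exact b.norm_eq_one _
    · rw [← Submodule.coe_inner]; exact b.inner_eq_zero (Fin.ne_of_val_ne (by simp))
  obtain ⟨hw₂0, hw₂ℓ⟩ := hmem w₂ hw₂
  obtain ⟨hw₃0, hw₃ℓ⟩ := hmem w₃ hw₃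
  -- Gram–Schmidt for `G` on `w₂, w₃`: first leg
  have hw₂ne : w₂ ≠ 0 := by
    intro h
    rw [h, norm_zero] at hn₂
    exact zero_ne_one hn₂
  obtain ⟨u₂, c₂, hu₂eq, hGu₂, hnu₂⟩ := screen_normalise hpin w₂ hw₂0 hw₂ne
  have hu₂0 : u₂ 0 = 0 := by rw [hu₂eq, PiLp.smul_apply, hw₂0, smul_zero]
  have hu₂ℓ : G u₂ ℓ = 0 := by rw [hu₂eq, map_smul, smul_apply, hw₂ℓ, smul_zero]
  -- the residual `r = w₃ − G(w₃, u₂) u₂`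
  obtain ⟨r, hr⟩ : ∃ r : E4, r = w₃ - G w₃ u₂ • u₂ := ⟨_, rfl⟩
  have hrne : r ≠ 0 := by
    rw [hr, hu₂eq, smul_smul]
    exact screen_residual_ne_zero hn₃ h₂₃ _
  have hr0 : r 0 = 0 := by
    rw [hr, PiLp.sub_apply, PiLp.smul_apply, hw₃0, hu₂0, smul_zero, sub_zero]
  have hrℓ : G r ℓ = 0 := by
    rw [hr, map_sub, map_smul, sub_apply, smul_apply, hw₃ℓ, hu₂ℓ, smul_zero, sub_zero]
  have hu₂r : G u₂ r = 0 := by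
    rw [hr, map_sub, map_smul, hGu₂, smul_eq_mul, mul_one, hG u₂ w₃, sub_self]
  -- second leg
  obtain ⟨u₃, c₃, hu₃eq, hGu₃, hnu₃⟩ := screen_normalise hpin r hr0 hrne
  have hu₃ℓ : G u₃ ℓ = 0 := by rw [hu₃eq, map_smul, smul_apply, hrℓ, smul_zero]
  have hu₂₃ : G u₂ u₃ = 0 := by rw [hu₃eq, map_smul, hu₂r, smul_zero]
  -- `n`-correction
  refine ⟨u₂ + G u₂ n • ℓ, u₃ + G u₃ n • ℓ, ?_, ?_, ?_, ?_, ?_, ?_, ?_, ?_, ?_⟩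
  · exact (screen_shift_shift G hG hℓ hu₂ℓ hu₂ℓ _ _).trans hGu₂
  · exact (screen_shift_shift G hG hℓ hu₃ℓ hu₃ℓ _ _).trans hGu₃
  · exact (screen_shift_shift G hG hℓ hu₂ℓ hu₃ℓ _ _).trans hu₂₃
  · exact screen_shift_ℓ G hℓ ((hG ℓ u₂).trans hu₂ℓ) _
  · exact screen_shift_ℓ G hℓ ((hG ℓ u₃).trans hu₃ℓ) _
  · exact screen_shift_n G hG hℓn u₂
  · exact screen_shift_n G hG hℓn u₃
  · exact screen_shift_norm hpin ℓ n u₂ hnu₂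
  · exact screen_shift_norm hpin ℓ n u₃ hnu₃

end Summit.FinalStateConjecture.FinalStateConjecture.Theorems.PhotonSphereChannels.TameCensorshipUnwind

end
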